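import Mathlib
import HarnessLib
import Summits.Parity.GeneralizedHardyLittlewood.Theses.ShiftedMultiplicationTable

/-!
# Refutation of `ShiftedMultiplicationTable.RectangleChowla` (stmt-Parity-4218)

`Summit.Parity.GeneralizedHardyLittlewood.Theses.ShiftedMultiplicationTable.RectangleChowla`
quantifies over EVERY `δ > 0` and every `A` in the window `x ^ δ ≤ A ≤ x ^ (1/3 + δ)`. Nothing
keeps the window inside the Type-II range: for `δ = 1` the choice `A = x` is admissible, the
`b`-range `Finset.Icc 1 ⌊x / A⌋₊` collapses to `{1}`, and the "fourth moment" becomes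
`∑_{a, a' ∈ (x, 2x]} (λ(a+c) λ(a'+c))² = (⌊2x⌋ - ⌊x⌋)²`, with no cancellation possible
(`λ = ±1`). At `x = N ∈ ℕ`, `N ≥ 3`, `c = 1`, `C = 1` this reads `N² ≤ N² / log N`, i.e.
`log N ≤ 1`, false. (The same degeneration `⌊x/A⌋₊ = 1` is available for every `δ ∈ [2/3, 1]`.)

The intended statement needs the side condition `δ < 1/3` (or one fixed small `δ₀`: the planner's
Heath-Brown bookkeeping uses `δ = ρ/3`), so that `B = x/A ≥ x^{2/3-δ} → ∞`. [folklore]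
-/

namespace Summit.Parity.GeneralizedHardyLittlewood.Theorems

/-- Refutes `ShiftedMultiplicationTable.RectangleChowla`: with `c = 1`, `δ = 1`, `C = 1`,
`x = A = N` (`N ≥ 3` a natural number beyond the claimed threshold) the window condition
`x^δ ≤ A ≤ x^{4/3}` holds, `⌊x/A⌋₊ = 1`, every summand is `(λ(a+1)λ(a'+1))² = 1`, so the left side
is `N·N` while the right side is `N²/log N < N²`. [folklore] -/
theorem ShiftedMultiplicationTableRectangleChowla_refuted :
    ¬ Summit.Parity.GeneralizedHardyLittlewood.Theses.ShiftedMultiplicationTable.RectangleChowla := by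
  intro h
  obtain ⟨x₀, hx₀⟩ := h 1 one_ne_zero 1 one_pos 1 one_pos
  obtain ⟨N, hN⟩ := exists_nat_ge (max x₀ 3)
  have hN3 : (3 : ℝ) ≤ N := le_trans (le_max_right _ _) hN
  have hNx : x₀ ≤ N := le_trans (le_max_left _ _) hN
  have hN1 : (1 : ℝ) ≤ N := by linarith
  have hNpos : (0 : ℝ) < N := by linarith
  have hwin1 : (N : ℝ) ^ (1 : ℝ) ≤ N := by rw [Real.rpow_one]
  have hwin2 : (N : ℝ) ≤ (N : ℝ) ^ (1 / 3 + 1 : ℝ) := by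
    calc (N : ℝ) = (N : ℝ) ^ (1 : ℝ) := (Real.rpow_one _).symm
      _ ≤ (N : ℝ) ^ (1 / 3 + 1 : ℝ) := Real.rpow_le_rpow_of_exponent_le hN1 (by norm_num)
  have key := hx₀ (N : ℝ) hNx (N : ℝ) hwin1 hwin2
  have hfl1 : ⌊(N : ℝ)⌋₊ = N := Nat.floor_natCast N
  have hfl2 : ⌊2 * (N : ℝ)⌋₊ = 2 * N := by
    have : (2 * (N : ℝ)) = ((2 * N : ℕ) : ℝ) := by push_cast; ring
    rw [this, Nat.floor_natCast]
  have hfl3 : ⌊(N : ℝ) / (N : ℝ)⌋₊ = 1 := by rw [div_self hNpos.ne', Nat.floor_one]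
  rw [hfl1, hfl2, hfl3, Real.rpow_one] at key
  -- every summand equals `1`
  have hterm : ∀ a a' : ℕ,
      (∑ b ∈ Finset.Icc (1 : ℕ) 1,
          (ArithmeticFunction.liouville (Int.toNat ((a : ℤ) * (b : ℕ) + 1)) : ℝ) *
            (ArithmeticFunction.liouville (Int.toNat ((a' : ℤ) * (b : ℕ) + 1)) : ℝ)) ^ 2 = 1 := by
    intro a a'
    rw [Finset.Icc_self, Finset.sum_singleton]
    simp only [Nat.cast_one, mul_one]
    rw [show ((a : ℤ) + 1) = ((a + 1 : ℕ) : ℤ) by push_cast; ring,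
      show ((a' : ℤ) + 1) = ((a' + 1 : ℕ) : ℤ) by push_cast; ring,
      Int.toNat_natCast, Int.toNat_natCast,
      ArithmeticFunction.liouville_apply (Nat.succ_ne_zero a),
      ArithmeticFunction.liouville_apply (Nat.succ_ne_zero a')]
    push_cast
    rw [← pow_add, ← pow_mul, mul_comm, pow_mul]
    norm_num
  simp_rw [hterm] at key
  rw [Finset.sum_const, Finset.sum_const, Nat.card_Ioc, nsmul_eq_mul, nsmul_eq_mul,
    show 2 * N - N = N by omega, mul_one] at key
  -- `key : N * N ≤ N ^ 2 / log N`, but `log N > 1`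
  have hlog : 1 < Real.log N := by
    rw [Real.lt_log_iff_exp_lt hNpos]
    exact lt_of_lt_of_le (by have := Real.exp_one_lt_d9; linarith) hN3
  have hlt : (N : ℝ) ^ 2 / Real.log N < (N : ℝ) ^ 2 := div_lt_self (by positivity) hlog
  have : (N : ℝ) * N < (N : ℝ) * N := by
    calc (N : ℝ) * N ≤ (N : ℝ) ^ 2 / Real.log N := key
      _ < (N : ℝ) ^ 2 := hlt
      _ = (N : ℝ) * N := by ring
  exact lt_irrefl _ this

end Summit.Parity.GeneralizedHardyLittlewood.Theorems
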